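import Summits.ResolutionOfSingularities.ResolutionOfSingularities.Theorems.FrobeniusClosingSteerConstOrderBinaryForm
import Literature.AlgebraicGeometry.Hironaka2017.Lib.DiffPowerCoordArrangement
import HarnessLib

/-!
# Steer σ-residual — §σ2.26 (B3) CORE, characteristic `p`: a form of degree divisible by `p` whose partial derivatives omit the
# centre variable is a binary form modulo `p`-th powers (`F_d = A_d(U, V) + H ^ p`)

OURS (campaign res-hironaka, rung L ★L-G4, slot W4.1, crux `Steer` stmt-ResolutionOfSingularities-16345; sibling of
`…ConstOrderBinaryForm` p523044 (the `p = 2` statement of res-L0-w41-strat-2 MEMO rev 12 §6⁗ (B3), res-L0-w41-plan-1 RULING 75), in the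
`(p, e)`-form of the words of record `NoEternalConstOrderIsolatedChain p c (p*e)` (RULING 80); res-type-026 own after-care 10:23:43Z,
kept out of the first file by the 400-line rule). Theses-free, definition-free; AI-produced, weaker than expert review; nothing here
is a statement of the manuscript under review.

* `exists_add_of_forall_pderiv_free` — ANY field of characteristic `p` (imperfect allowed — the residue fields of the F-A3 funnel
  are function fields, res-type-096 10:24:07Z (1)): `F = A + B`, `A` free of `w`, `B ∈ κ[X_i^p]`, both homogeneous of degree `d`;
* **`exists_add_pow_of_forall_pderiv_free`** — `κ` perfect of characteristic `p`, `F` homogeneous of degree `d` with `p ∣ d`, every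
  `∂ᵢ F` free of `w` ⇒ `F = A + H ^ p`, `A` free of `w` and homogeneous of degree `d`, `H` homogeneous of degree `d / p`.
  Same proof as the `p = 2` case: the exponents of the `w`-part are divisible by `p` — for `i ≠ w` by the `∂ᵢ` test, for `w` by the
  `∂_w` test unless the `w`-exponent is `1`, which is excluded since it would force `d ≡ 1 (mod p)`.
-/

noncomputable section

-- single-problem summit: the doubled namespace component `ResolutionOfSingularities` is forced
set_option linter.dupNamespace false

namespace Summit.ResolutionOfSingularities.ResolutionOfSingularities.Theorems.SwitchingDichotomy.ConstOrder

open MvPolynomial Finset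

section CharP

/-- **Split form, ANY field of characteristic `p` (no perfectness).** If `F` is homogeneous of degree `d` with `p ∣ d` and every
partial derivative `∂ᵢ F` is free of the variable `w`, then `F = A + B` with `A` free of `w` and `B ∈ κ[X_i^p : i]` (every exponent
of every monomial of `B` divisible by `p`), both homogeneous of degree `d`. Over an IMPERFECT `κ` (e.g. residue fields at
non-closed points) this is the honest normal form: `B` need not be a `p`-th power. [folklore] -/
theorem exists_add_of_forall_pderiv_free {κ σ : Type*} [Field κ] (p : ℕ) [Fact p.Prime] [CharP κ p]
    (w : σ) {F : MvPolynomial σ κ} {d : ℕ} (hF : F.IsHomogeneous d) (hd : p ∣ d)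
    (h : ∀ i, ∀ m ∈ (pderiv i F).support, m w = 0) :
    ∃ A B : MvPolynomial σ κ, (∀ m ∈ A.support, m w = 0) ∧ A.IsHomogeneous d ∧
      (∀ m ∈ B.support, ∀ i, p ∣ m i) ∧ B.IsHomogeneous d ∧ F = A + B := by
  classical
  have hp : p.Prime := Fact.out
  -- split `F = A + B` along «`w` occurs»
  set A : MvPolynomial σ κ := ∑ m ∈ F.support with m w = 0, monomial m (coeff m F) with hA
  set B : MvPolynomial σ κ := ∑ m ∈ F.support with ¬ m w = 0, monomial m (coeff m F) with hB
  have hAB : F = A + B := by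
    conv_lhs => rw [← support_sum_monomial_coeff F]
    rw [hA, hB, Finset.sum_filter_add_sum_filter_not]
  have hcoeffA : ∀ n, coeff n A = if n w = 0 then coeff n F else 0 := by
    intro n
    rw [hA, coeff_sum]
    simp_rw [coeff_monomial]
    rw [Finset.sum_ite_eq']
    simp only [Finset.mem_filter, MvPolynomial.mem_support_iff, ne_eq]
    by_cases hn : coeff n F = 0
    · simp [hn]
    · simp [hn]
  have hcoeffB : ∀ n, coeff n B = if n w = 0 then 0 else coeff n F := by
    intro n
    rw [hB, coeff_sum]
    simp_rw [coeff_monomial]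
    rw [Finset.sum_ite_eq']
    simp only [Finset.mem_filter, MvPolynomial.mem_support_iff, ne_eq]
    by_cases hn : coeff n F = 0
    · simp [hn]
    · by_cases hnw : n w = 0 <;> simp [hn, hnw]
  have hsuppA : ∀ m ∈ A.support, m w = 0 ∧ m ∈ F.support := by
    intro m hm
    rw [MvPolynomial.mem_support_iff, hcoeffA] at hm
    by_cases hmw : m w = 0
    · rw [if_pos hmw] at hm
      exact ⟨hmw, MvPolynomial.mem_support_iff.mpr hm⟩
    · rw [if_neg hmw] at hm
      exact (hm rfl).elim
  have hsuppB : ∀ m ∈ B.support, m w ≠ 0 ∧ m ∈ F.support := by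
    intro m hm
    rw [MvPolynomial.mem_support_iff, hcoeffB] at hm
    by_cases hmw : m w = 0
    · rw [if_pos hmw] at hm
      exact (hm rfl).elim
    · rw [if_neg hmw] at hm
      exact ⟨hmw, MvPolynomial.mem_support_iff.mpr hm⟩
  -- the derivative test: an exponent `m i` NOT divisible by `p` puts `m - e_i` into the support of `∂_i F`
  have htest : ∀ i, ∀ m ∈ F.support, ¬ p ∣ m i → (m - Finsupp.single i 1) ∈ (pderiv i F).support := by
    intro i m hm hnd
    have hmi : 1 ≤ m i := Nat.one_le_iff_ne_zero.2 fun h0 => hnd (h0 ▸ dvd_zero p)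
    have e : m = (m - Finsupp.single i 1) + Finsupp.single i 1 := by
      ext j
      simp only [Finsupp.coe_add, Finsupp.coe_tsub, Pi.add_apply, Pi.sub_apply, Finsupp.single_apply]
      split_ifs with hij
      · subst hij; omega
      · omega
    rw [MvPolynomial.mem_support_iff, coeff_pderiv, ← e]
    have hval : ((m - Finsupp.single i 1 : σ →₀ ℕ) i : κ) + 1 = (m i : κ) := by
      rw [← Nat.cast_succ, Finsupp.tsub_apply, Finsupp.single_eq_same]
      congr 1
      omega
    rw [hval]
    refine mul_ne_zero (MvPolynomial.mem_support_iff.mp hm) fun hcast => hnd ?_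
    exact (CharP.cast_eq_zero_iff κ p (m i)).1 hcast
  -- every exponent of every monomial of `B` is divisible by `p`
  have hdvd : ∀ m ∈ B.support, ∀ i, p ∣ m i := by
    intro m hmB i
    obtain ⟨hmw, hmF⟩ := hsuppB m hmB
    by_contra hnd
    by_cases hiw : i = w
    · subst hiw
      by_cases h1 : m i = 1
      · -- all other exponents are divisible by `p`, so `d = 1 + (multiple of p)`: impossible as `p ∣ d`
        have hothers : ∀ j, j ≠ i → p ∣ m j := by
          intro j hj
          by_contra hndj
          have hmem := htest j m hmF hndj
          have := h j _ hmem
          rw [Finsupp.tsub_apply, Finsupp.single_eq_of_ne' hj] at this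
          omega
        have hdeg : m.degree = d := degree_eq_of_mem_support_of_isHomogeneous hF hmF
        rw [Finsupp.degree_apply] at hdeg
        have hsplit : ∑ j ∈ m.support, m j = m i + ∑ j ∈ m.support.erase i, m j := by
          rw [← Finset.add_sum_erase m.support (fun j => m j) (Finsupp.mem_support_iff.mpr (by omega))]
        have hdvdsum : p ∣ ∑ j ∈ m.support.erase i, m j :=
          Finset.dvd_sum fun j hj => hothers j (Finset.ne_of_mem_erase hj)
        rw [hsplit, h1] at hdeg
        obtain ⟨a, ha⟩ := hd
        obtain ⟨b, hb⟩ := hdvdsum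
        rw [hb, ha] at hdeg
        have hsub : p * a - p * b = 1 := Nat.sub_eq_of_eq_add (by rw [← hdeg, add_comm])
        have hp1 : p ∣ 1 := by
          rw [← hsub]
          exact Nat.dvd_sub (dvd_mul_right p a) (dvd_mul_right p b)
        exact hp.one_lt.ne' (Nat.dvd_one.mp hp1)
      · have hmem := htest i m hmF hnd
        have := h i _ hmem
        rw [Finsupp.tsub_apply, Finsupp.single_eq_same] at this
        omega
    · have hmem := htest i m hmF hnd
      have := h i _ hmem
      rw [Finsupp.tsub_apply, Finsupp.single_eq_of_ne' hiw] at this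
      exact hmw (by omega)
  refine ⟨A, B, fun m hm => (hsuppA m hm).1, ?_, hdvd, ?_, hAB⟩
  · intro m hm
    have hmF := (hsuppA m (MvPolynomial.mem_support_iff.mpr hm)).2
    have := degree_eq_of_mem_support_of_isHomogeneous hF hmF
    rw [Finsupp.degree_eq_weight_one] at this
    exact this
  · intro m hm
    have hmF := (hsuppB m (MvPolynomial.mem_support_iff.mpr hm)).2
    have := degree_eq_of_mem_support_of_isHomogeneous hF hmF
    rw [Finsupp.degree_eq_weight_one] at this
    exact this

/-- **Binary form modulo `p`-th powers (characteristic `p`, perfect field).** Over a perfect field of characteristic `p`: if `F` is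
homogeneous of degree `d` with `p ∣ d` and every partial derivative `∂ᵢ F` is free of the variable `w`, then `F = A + H ^ p` with
`A` free of `w` and homogeneous of degree `d`, `H` homogeneous of degree `d / p`. [folklore] -/
theorem exists_add_pow_of_forall_pderiv_free {κ σ : Type*} [Field κ] (p : ℕ) [Fact p.Prime] [CharP κ p] [PerfectRing κ p]
    (w : σ) {F : MvPolynomial σ κ} {d : ℕ} (hF : F.IsHomogeneous d) (hd : p ∣ d)
    (h : ∀ i, ∀ m ∈ (pderiv i F).support, m w = 0) :
    ∃ A H : MvPolynomial σ κ, (∀ m ∈ A.support, m w = 0) ∧ A.IsHomogeneous d ∧ H.IsHomogeneous (d / p) ∧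
      F = A + H ^ p := by
  classical
  have hp : p.Prime := Fact.out
  obtain ⟨A, B, hAw, hAh, hBdvd, hBh, hAB⟩ := exists_add_of_forall_pderiv_free p w hF hd h
  obtain ⟨H, hH, hHsupp⟩ := exists_pow_eq_of_forall_dvd p hBdvd
  refine ⟨A, H, hAw, hAh, ?_, by rw [hAB, hH]⟩
  intro n hn
  have hnB := hHsupp n (MvPolynomial.mem_support_iff.mpr hn)
  have hdeg := degree_eq_of_mem_support_of_isHomogeneous hBh hnB
  rw [map_nsmul, smul_eq_mul] at hdeg
  have : n.degree = d / p := (Nat.div_eq_of_eq_mul_left hp.pos (by rw [mul_comm]; exact hdeg.symm)).symm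
  rw [Finsupp.degree_eq_weight_one] at this
  exact this

end CharP

/-! ## v2 (append) — the rational-centre half of (B3): «multiplicity `δ` at the `w`-point» ⟺ «free of `w`»

For a homogeneous form `P` of degree `δ` (an initial form `(D F_m)_δ`), «`P` has multiplicity `δ` at the rational point where all
coordinates but `w` vanish» is membership in `𝔭^δ`, `𝔭 = (X_i : i ≠ w)`; by the tree's monomial criterion
(`CoordArrangement.mem_pow_span_X_iff`) this says every monomial has `(Σ_{i ≠ w} m i) ≥ δ = Σ_i m i`, i.e. `m w = 0`. So the
hypothesis «all `∂ᵢ F_d ∈ κ[U, V]`» of the normal-form theorems is literally «all `∂ᵢ F_d` have multiplicity `δ` at the `W`-point». -/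

section RationalCentre

open Literature.AlgebraicGeometry.Hironaka2017.SpanXValuation

universe u

/-- `S`-degree along the complement of one variable: `sdeg {i ≠ w} m + m w = |m|`. [folklore] -/
theorem sdeg_ne_add_apply {σ : Type*} (w : σ) (m : σ →₀ ℕ) : sdeg {i | i ≠ w} m + m w = m.degree := by
  classical
  rw [sdeg, Finsupp.weight_apply, Finsupp.degree_apply, Finsupp.sum]
  by_cases hw : w ∈ m.support
  · rw [← Finset.add_sum_erase _ _ hw, ← Finset.add_sum_erase _ (fun i => m i) hw,
      indWeight_of_not_mem (S := {i | i ≠ w}) (by simp), smul_zero, zero_add, add_comm]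
    congr 1
    exact Finset.sum_congr rfl fun i hi => by
      rw [indWeight_of_mem (S := {i | i ≠ w}) (by simpa using Finset.ne_of_mem_erase hi), smul_eq_mul, mul_one]
  · have hw0 : m w = 0 := by simpa using hw
    rw [hw0, add_zero]
    exact Finset.sum_congr rfl fun i hi => by
      have hiw : i ≠ w := fun h => hw (h ▸ hi)
      rw [indWeight_of_mem (S := {i | i ≠ w}) (by simpa using hiw), smul_eq_mul, mul_one]

/-- **Multiplicity `δ` at the `w`-point ⟺ free of `w`** for a homogeneous form of degree `δ` over a field:
`P ∈ (X_i : i ≠ w)^δ ↔ ∀ m ∈ supp P, m w = 0`. [folklore] -/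
theorem mem_pow_span_X_ne_iff_forall_apply_eq_zero {κ σ : Type u} [Field κ] (w : σ) {P : MvPolynomial σ κ} {δ : ℕ}
    (hP : P.IsHomogeneous δ) : P ∈ Ideal.span (X '' {i | i ≠ w}) ^ δ ↔ ∀ m ∈ P.support, m w = 0 := by
  rw [Literature.AlgebraicGeometry.Hironaka2017.CoordArrangement.mem_pow_span_X_iff]
  refine forall₂_congr fun m hm => ?_
  have hdeg := degree_eq_of_mem_support_of_isHomogeneous hP hm
  have hadd := sdeg_ne_add_apply w m
  constructor
  · intro h; omega
  · intro h0; omega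

/-- The normal form with the GEOMETRIC hypothesis: characteristic `p`, `F` homogeneous of degree `d` with `p ∣ d`, and every
`∂ᵢ F` (homogeneous of degree `d - 1`) of multiplicity `d - 1` at the `w`-point, i.e. `∂ᵢ F ∈ (X_j : j ≠ w)^(d-1)` ⇒ `F = A + B`,
`A` free of `w`, `B ∈ κ[X_j^p]`. [folklore] -/
theorem exists_add_of_forall_pderiv_mem_pow {κ σ : Type u} [Field κ] (p : ℕ) [Fact p.Prime] [CharP κ p]
    (w : σ) {F : MvPolynomial σ κ} {d : ℕ} (hF : F.IsHomogeneous d) (hd : p ∣ d)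
    (h : ∀ i, pderiv i F ∈ Ideal.span (X '' {j | j ≠ w}) ^ (d - 1)) :
    ∃ A B : MvPolynomial σ κ, (∀ m ∈ A.support, m w = 0) ∧ A.IsHomogeneous d ∧
      (∀ m ∈ B.support, ∀ i, p ∣ m i) ∧ B.IsHomogeneous d ∧ F = A + B := by
  refine exists_add_of_forall_pderiv_free p w hF hd fun i => ?_
  exact (mem_pow_span_X_ne_iff_forall_apply_eq_zero w (hF.pderiv (i := i))).mp (h i)

end RationalCentre

end Summit.ResolutionOfSingularities.ResolutionOfSingularities.Theorems.SwitchingDichotomy.ConstOrder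

end
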